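import Literature.Probability.Percolation.SeedLemma
import HarnessLib

/-!
# Exploration of the open clusters of a region from an inner set (definitions)

Topic `Literature/Probability/Percolation` (file `BlockExploration.lean`; unrelated to the query-process `ClusterExploration.lean`). The decoupling device of D. Basu, A. Sapozhnikov,
*Kesten's incipient infinite cluster and quasi-multiplicativity of crossing probabilities*,
Electron. Commun. Probab. 22 (2017), §2, eq. (2.3) ("the random sets `𝒞ᵢ`, `𝒟ᵢ`"), which replaces
Kesten's innermost open circuits (H. Kesten, PTRF 73 (1986), §2) by an exploration FROM INSIDE that
needs no planarity: for a bond configuration `ω` on a vertex type `V`, an inner vertex set `In` and a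
surrounding block `Blk`,

* `explSet In Blk ω` — the EXPLORED SET: `In` together with the vertices of `Blk` joined to a vertex
  of `In` by an `ω`-open path all of whose vertices lie in `In ∪ Blk` (Basu–Sapozhnikov's
  `𝒞 = {x ∈ B(v,N') : x ↔ B(v,N) in B(v,N')}`, with `In = B(v,N)`, `Blk = B(v,N') ∖ B(v,N)`);
* `explRim In Blk ω` — the RIM: the vertices outside the explored set joined to it by an open edge
  (their `𝒟`); they lie outside `In ∪ Blk` (`explRim_disjoint`);
* `explEvent In Blk U R` — the datum event `{𝒞 = U, 𝒟 = R}`;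
* `explRimLinked In Blk ω` — any two rim vertices are joined by an open path inside
  `explSet ∪ explRim` ("the rim hangs off ONE explored cluster"; in the plane it follows from an open
  circuit in the block, in general it is Basu–Sapozhnikov's uniqueness event `Fᵢ`).

Why these objects: on `explEvent In Blk U R` every open edge leaving `U` ends in `R`, the event is
determined by the edges touching `Blk` (when `In` has no neighbour outside `In ∪ Blk`), and — for a
random-cluster measure — conditionally on it the configuration off `U` is the random-cluster measure of
the graph deprived of `U` with the rim `R` wired (`RandomClusterRimWiring*.lean`), which is the exact
domain Markov decoupling behind Kesten's ratio-limit theorem for dependent models. Only definitions and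
their immediate unfoldings are here; the combinatorial API is in the companion proof files.

## References
* [BasuSapozhnikov2017ECP] D. Basu, A. Sapozhnikov, ECP 22 (2017) no. 26, §2 eq. (2.3) and the
  paragraph after it.
* [Kesten1986] H. Kesten, Probab. Theory Related Fields 73 (1986) 369–394, §2.
-/

namespace Literature.Probability.Percolation

variable {V : Type*}

/-- **The explored set** of the block `Blk` from the inner set `In` in the configuration `ω`: `In`
together with the vertices of `Blk` joined to some vertex of `In` by an `ω`-open path inside
`In ∪ Blk` (Basu–Sapozhnikov's `𝒞ᵢ`). [cite: BasuSapozhnikov2017ECP, §2 eq. (2.3)] -/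
def explSet (In Blk : Set V) (ω : BondConfig V) : Set V :=
  In ∪ {v | v ∈ Blk ∧ ∃ u ∈ In, ω ∈ openConnIn (In ∪ Blk) u v}

/-- **The rim** of the exploration: the vertices outside the explored set joined to a vertex of it by
an open edge (Basu–Sapozhnikov's `𝒟ᵢ`). [cite: BasuSapozhnikov2017ECP, §2 eq. (2.3)] -/
def explRim (In Blk : Set V) (ω : BondConfig V) : Set V :=
  {w | w ∉ explSet In Blk ω ∧ ∃ v ∈ explSet In Blk ω, s(v, w) ∈ ω}

/-- **The exploration datum event** `{𝒞 = U, 𝒟 = R}` (Basu–Sapozhnikov's `Fᵢ(U, R)` without the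
uniqueness clause). [cite: BasuSapozhnikov2017ECP, §2, definition of F_i(U,R)] -/
def explEvent (In Blk U R : Set V) : Set (BondConfig V) :=
  {ω | explSet In Blk ω = U ∧ explRim In Blk ω = R}

/-- **Linked rim**: any two rim vertices are joined by an `ω`-open path all of whose vertices lie in
the explored set or the rim — the rim hangs off one explored open cluster, so that it may be WIRED when
the explored set is conditioned upon (Basu–Sapozhnikov's use of the uniqueness event `Fᵢ`).
[cite: BasuSapozhnikov2017ECP, §2, paragraph after eq. (2.3)] -/
def explRimLinked (In Blk : Set V) (ω : BondConfig V) : Prop :=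
  ∀ r ∈ explRim In Blk ω, ∀ r' ∈ explRim In Blk ω,
    ω ∈ openConnIn (explSet In Blk ω ∪ explRim In Blk ω) r r'

/-- Membership in the explored set, unfolded. [cite: BasuSapozhnikov2017ECP, §2 eq. (2.3)] -/
theorem mem_explSet_iff {In Blk : Set V} {ω : BondConfig V} {v : V} :
    v ∈ explSet In Blk ω ↔ v ∈ In ∨ (v ∈ Blk ∧ ∃ u ∈ In, ω ∈ openConnIn (In ∪ Blk) u v) :=
  Iff.rfl

/-- Membership in the rim, unfolded. [cite: BasuSapozhnikov2017ECP, §2 eq. (2.3)] -/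
theorem mem_explRim_iff {In Blk : Set V} {ω : BondConfig V} {w : V} :
    w ∈ explRim In Blk ω ↔ w ∉ explSet In Blk ω ∧ ∃ v ∈ explSet In Blk ω, s(v, w) ∈ ω :=
  Iff.rfl

/-- Membership in the datum event, unfolded. [cite: BasuSapozhnikov2017ECP, §2] -/
theorem mem_explEvent_iff {In Blk U R : Set V} {ω : BondConfig V} :
    ω ∈ explEvent In Blk U R ↔ explSet In Blk ω = U ∧ explRim In Blk ω = R :=
  Iff.rfl

/-- The inner set is explored. [cite: BasuSapozhnikov2017ECP, §2 ("𝒞ᵢ contains B(v,Nᵢ)")] -/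
theorem subset_explSet (In Blk : Set V) (ω : BondConfig V) : In ⊆ explSet In Blk ω :=
  fun _ hv => Or.inl hv

/-- The explored set lies in `In ∪ Blk`. [cite: BasuSapozhnikov2017ECP, §2 eq. (2.3)] -/
theorem explSet_subset (In Blk : Set V) (ω : BondConfig V) : explSet In Blk ω ⊆ In ∪ Blk := by
  rintro v (hv | ⟨hv, -⟩)
  · exact Or.inl hv
  · exact Or.inr hv

/-- The datum events are pairwise disjoint. [cite: BasuSapozhnikov2017ECP, §2 ("F_i = ∪ F_i(U,R)", disjoint union)] -/
theorem disjoint_explEvent {In Blk U R U' R' : Set V} (h : (U, R) ≠ (U', R')) :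
    Disjoint (explEvent In Blk U R) (explEvent In Blk U' R') := by
  rw [Set.disjoint_left]
  rintro ω ⟨h1, h2⟩ ⟨h3, h4⟩
  exact h (Prod.ext (h1.symm.trans h3) (h2.symm.trans h4))

/-- Every configuration lies in exactly its own datum event. [cite: BasuSapozhnikov2017ECP, §2] -/
theorem mem_explEvent_self (In Blk : Set V) (ω : BondConfig V) :
    ω ∈ explEvent In Blk (explSet In Blk ω) (explRim In Blk ω) :=
  ⟨rfl, rfl⟩

end Literature.Probability.Percolation

/-! ### The rim wired through the explored set (appended 2026-08-16, lead c3)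

`explRimLinked` allows the linking path to run along an edge joining two rim vertices; the domain
Markov property at the explored set (`RandomClusterRimWiring*.lean`) needs the rim to be joined
through OPEN EDGES TOUCHING THE EXPLORED SET. The stronger event below records exactly that; it is
what an open separating vertex set inside the block provides. -/

namespace Literature.Probability.Percolation

variable {V : Type*}

/-- **Rim wired from inside**: any two rim vertices carry open edges to two vertices of the explored
set that are joined by an open path INSIDE the explored set (so the rim is one cluster of the open
edges touching the explored set — the hypothesis of the rim-wiring domain Markov property).
[cite: BasuSapozhnikov2017ECP, §2, paragraph after eq. (2.3)] -/
def explRimWired (In Blk : Set V) (ω : BondConfig V) : Prop :=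
  ∀ r ∈ explRim In Blk ω, ∀ r' ∈ explRim In Blk ω, ∃ v ∈ explSet In Blk ω, ∃ v' ∈ explSet In Blk ω,
    s(v, r) ∈ ω ∧ s(v', r') ∈ ω ∧ ω ∈ openConnIn (explSet In Blk ω) v v'

/-- `explRimWired`, unfolded. [cite: BasuSapozhnikov2017ECP, §2] -/
theorem explRimWired_iff {In Blk : Set V} {ω : BondConfig V} :
    explRimWired In Blk ω ↔
      ∀ r ∈ explRim In Blk ω, ∀ r' ∈ explRim In Blk ω, ∃ v ∈ explSet In Blk ω,
        ∃ v' ∈ explSet In Blk ω, s(v, r) ∈ ω ∧ s(v', r') ∈ ω ∧ ω ∈ openConnIn (explSet In Blk ω) v v' :=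
  Iff.rfl

end Literature.Probability.Percolation
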